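import Summits.AtomisticToContinuum.Crystallization.Theorems.NashClassCertificatesNashTwoShellGapForceBalance
import Summits.AtomisticToContinuum.Crystallization.Theorems.FreeSplittingCertificatesDefectVanishOfStrict

/-!
# Crux `NashTwoShellGap` (stmt-AtomisticToContinuum-16826), line `birth`: the virial identity

Registered sub-goals `stub_nashVirial` (primary) and `stub_nashEnergyVirial` (corollary).

An exact global consequence of force balance (`NashTwoShellGapForceBalance.stub_nashForceBalance`,
`F_i := ∑_{j ≠ i} c_ij (x_i − x_j) = 0` with `c_ij = c_ji = r_ij⁻⁸ − r_ij⁻¹⁴`, `r_ij = |x_i − x_j|`)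
for a `1/3`-separated Nash Lennard-Jones configuration:

  `0 = ∑_i ⟪F_i, x_i⟫ = ∑_i ∑_{j ≠ i} c_ij ⟪x_i − x_j, x_i⟫`.

Swapping the two indices of the (symmetric) off-diagonal double sum (the tree lemma
`defectVanishOfStrict_sum_erase_comm` of `FreeSplittingCertificatesDefectVanishOfStrict`) and adding,
`⟪x_i − x_j, x_i⟫ + ⟪x_j − x_i, x_j⟫ = ‖x_i − x_j‖² = r_ij²` and `c_ij r_ij² = r_ij⁻⁶ − r_ij⁻¹²`, so
`∑_i ∑_{j ≠ i} (r_ij⁻⁶ − r_ij⁻¹²) = 0`; halving the ordered-pair sum (`two_mul_interactionEnergy`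
for the radial function `r ↦ r⁻⁶ − r⁻¹²`) gives the VIRIAL IDENTITY `∑_{i<j} (r_ij⁻⁶ − r_ij⁻¹²) = 0`
(`stub_nashVirial`), and then `𝓔_LJ(x) = ∑_{i<j} (r⁻¹²/12 − r⁻⁶/6) = −(1/12) ∑_{i<j} r_ij⁻¹²`
(`stub_nashEnergyVirial`).  No definitions; `[folklore]`.
-/

noncomputable section

namespace Summit.AtomisticToContinuum.Crystallization.Theorems.NashTwoShellGapVirial

open scoped BigOperators Classical RealInnerProductSpace
open Literature.MathematicalPhysics.StatisticalMechanics

/-- The radial algebra `(r⁻⁸ − r⁻¹⁴) r² = r⁻⁶ − r⁻¹²` (also at `r = 0`, where both sides vanish by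
`0⁻¹ = 0`). [folklore] -/
theorem radial_identity (r : ℝ) :
    (r⁻¹ ^ 8 - r⁻¹ ^ 14) * r ^ 2 = r⁻¹ ^ 6 - r⁻¹ ^ 12 := by
  rcases eq_or_ne r 0 with rfl | hr
  · simp
  · have h : r⁻¹ * r = 1 := inv_mul_cancel₀ hr
    calc (r⁻¹ ^ 8 - r⁻¹ ^ 14) * r ^ 2 = (r⁻¹ ^ 6 - r⁻¹ ^ 12) * (r⁻¹ * r) ^ 2 := by ring
      _ = r⁻¹ ^ 6 - r⁻¹ ^ 12 := by rw [h]; ring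

/-- **Virial symmetrisation.** If symmetric pair coefficients `c i j = c j i` balance the forces,
`∑_{j ≠ i} c i j • (x i − x j) = 0` for every `i`, then `∑_i ∑_{j ≠ i} c i j ‖x i − x j‖² = 0`:
pair `∑_i ⟪F_i, x_i⟫ = 0` with its index-swapped copy. [folklore] -/
theorem sum_sum_mul_norm_sq_eq_zero {N : ℕ} (x : Fin N → EuclideanSpace ℝ (Fin 3))
    (c : Fin N → Fin N → ℝ) (hsymm : ∀ i j, c i j = c j i)
    (hF : ∀ i, ∑ j ∈ Finset.univ.erase i, c i j • (x i - x j) = 0) :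
    ∑ i, ∑ j ∈ Finset.univ.erase i, c i j * ‖x i - x j‖ ^ 2 = 0 := by
  -- `∑_i ⟪F_i, x_i⟫ = 0`
  have h1 : ∑ i, ∑ j ∈ Finset.univ.erase i, c i j * ⟪x i - x j, x i⟫ = 0 := by
    refine Finset.sum_eq_zero fun i _ => ?_
    have h := congrArg (fun F : EuclideanSpace ℝ (Fin 3) => ⟪F, x i⟫) (hF i)
    simpa only [sum_inner, real_inner_smul_left, inner_zero_left] using h
  -- its index-swapped copy (off-diagonal index swap `defectVanishOfStrict_sum_erase_comm`, in tree)
  have h2 : ∑ i, ∑ j ∈ Finset.univ.erase i, c j i * ⟪x j - x i, x j⟫ = 0 := by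
    rw [← defectVanishOfStrict_sum_erase_comm (fun i j => c i j * ⟪x i - x j, x i⟫)]
    exact h1
  -- termwise sum of the two
  have h3 : ∀ i j, c i j * ⟪x i - x j, x i⟫ + c j i * ⟪x j - x i, x j⟫ = c i j * ‖x i - x j‖ ^ 2 := by
    intro i j
    rw [← hsymm i j, ← neg_sub (x i) (x j), inner_neg_left, ← real_inner_self_eq_norm_sq (x i - x j),
      inner_sub_right]
    ring
  calc ∑ i, ∑ j ∈ Finset.univ.erase i, c i j * ‖x i - x j‖ ^ 2
      = ∑ i, ∑ j ∈ Finset.univ.erase i, (c i j * ⟪x i - x j, x i⟫ + c j i * ⟪x j - x i, x j⟫) := by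
        simp only [h3]
    _ = 0 := by
        simp only [Finset.sum_add_distrib]
        rw [h1, h2, add_zero]

/-- **Registered sub-goal `stub_nashVirial`** (line `birth`): the VIRIAL IDENTITY
`∑_{i<j} (r_ij⁻⁶ − r_ij⁻¹²) = 0` for a `1/3`-separated Nash Lennard-Jones configuration — pair the
force balance `F_i = 0` (`stub_nashForceBalance`) with `x_i`, sum over `i`, symmetrise the
off-diagonal double sum (`c_ij r_ij² = r_ij⁻⁶ − r_ij⁻¹²`) and halve it (`two_mul_interactionEnergy`).
[folklore] -/
theorem stub_nashVirial : ∀ (N : ℕ) (x : Fin N → EuclideanSpace ℝ (Fin 3)), (∀ i j : Fin N, i ≠ j → 1 / 3 ≤ dist (x i) (x j)) → (∀ (i : Fin N) (y : EuclideanSpace ℝ (Fin 3)), (∀ j : Fin N, j ≠ i → y ≠ x j) → Literature.MathematicalPhysics.StatisticalMechanics.siteEnergy Literature.MathematicalPhysics.StatisticalMechanics.lennardJones x i ≤ ∑ j ∈ Finset.univ.erase i, Literature.MathematicalPhysics.StatisticalMechanics.lennardJones (dist y (x j))) → ∑ i : Fin N, ∑ j ∈ Finset.Ioi i, ((dist (x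 i) (x j))⁻¹ ^ 6 - (dist (x i) (x j))⁻¹ ^ 12) = 0 := by
  intro N x hsep hnash
  have hF := NashTwoShellGapForceBalance.stub_nashForceBalance N x hsep hnash
  -- the symmetrised ordered-pair sum vanishes
  have h3 : ∑ i, ∑ j ∈ Finset.univ.erase i, ((dist (x i) (x j))⁻¹ ^ 6 - (dist (x i) (x j))⁻¹ ^ 12) = 0 := by
    have hv := sum_sum_mul_norm_sq_eq_zero x
      (fun i j => (dist (x i) (x j))⁻¹ ^ 8 - (dist (x i) (x j))⁻¹ ^ 14)
      (fun i j => by rw [dist_comm]) hF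
    beta_reduce at hv
    rw [← hv]
    refine Finset.sum_congr rfl fun i _ => Finset.sum_congr rfl fun j _ => ?_
    rw [← dist_eq_norm (x i) (x j)]
    exact (radial_identity _).symm
  -- halve it
  have h2 := two_mul_interactionEnergy (fun r : ℝ => r⁻¹ ^ 6 - r⁻¹ ^ 12) x
  simp only [interactionEnergy, siteEnergy] at h2
  linarith

/-- **Registered sub-goal `stub_nashEnergyVirial`** (line `birth`, corollary of `stub_nashVirial`):
on a `1/3`-separated Nash Lennard-Jones configuration the energy is purely (minus one twelfth of) the
repulsive sum, `𝓔_LJ(x) = ∑_{i<j} (r⁻¹²/12 − r⁻⁶/6) = −(1/12) ∑_{i<j} r_ij⁻¹²`, since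
`∑_{i<j} r⁻⁶ = ∑_{i<j} r⁻¹²` by the virial identity. [folklore] -/
theorem stub_nashEnergyVirial : ∀ (N : ℕ) (x : Fin N → EuclideanSpace ℝ (Fin 3)), (∀ i j : Fin N, i ≠ j → 1 / 3 ≤ dist (x i) (x j)) → (∀ (i : Fin N) (y : EuclideanSpace ℝ (Fin 3)), (∀ j : Fin N, j ≠ i → y ≠ x j) → Literature.MathematicalPhysics.StatisticalMechanics.siteEnergy Literature.MathematicalPhysics.StatisticalMechanics.lennardJones x i ≤ ∑ j ∈ Finset.univ.erase i, Literature.MathematicalPhysics.StatisticalMechanics.lennardJones (dist y (x j))) → Literature.MathematicalPhysics.StatisticalMechanics.interactionEnergy Literature.MathematicalPhysics.StatisticalMechanics.lennardJones x = -(1 / 12) * ∑ i : Fin N, ∑ j ∈ Finset.Ioi i, (dist (x i) (x j))⁻¹ ^ 12 := by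
  intro N x hsep hnash
  have hv := stub_nashVirial N x hsep hnash
  simp only [Finset.sum_sub_distrib] at hv
  simp only [interactionEnergy, lennardJones, Finset.sum_sub_distrib, ← Finset.mul_sum]
  linear_combination (-(1 / 6) : ℝ) * hv

end Summit.AtomisticToContinuum.Crystallization.Theorems.NashTwoShellGapVirial

end
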